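import Mathlib
import HarnessLib
import Literature.Probability.MarkovChains.IndependenceSamplerSpectralGap
import Literature.Probability.MarkovChains.IndependenceMultiproposalGapBound
import Literature.Probability.MarkovChains.MinorizationSpectralGap
import Literature.Probability.MarkovChains.MultipleTryIndependenceSamplerEigenvectors
import Summits.Ventures.LatticeQCDFlow.Scoring.MultiProposalPeskun

/-!
# `k` fresh proposals per update cut the relaxation time of the exact flow-MCMC chain by AT MOST
# the factor `k`: `t_rel(IMH)/k = W/k ≤ t_rel` for both multi-proposal corrections, and the
# pool-selection (i-SIR) sandwich `W/k ≤ t_rel ≤ (2W + k − 1)/k`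

HONEST FRAMING: exact (Metropolis-corrected) sampling algorithms for lattice gauge theory;
figures of merit are autocorrelation/cost numbers at stated couplings and volumes; no
continuum-physics claim.

Venture `LatticeQCDFlow` (cell pub-lqcd), topic `Scoring`; row 33 (`lit-codes`,
literature-prover seat GEN-42).  NEW WORK of the cell — an elementary COMBINATION of Literature
theorems, stated because it closes the lower half of the relaxation-time sandwich for the lever
`imh.n_proposals_per_step` of `LEVERS.md` left open by GEN-41 (INBOX l.5172: "`W/k ≤ t_rel(i-SIR)`");
nothing here is cited as a fact and no definition is introduced.  The objects are the Literature ones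
(finite state space `X` with at least two points, target `p > 0`, `Σ p = 1`, model / proposal law
`q > 0`, `Σ q = 1`, importance weights `w = p/q ≤ W` with `W = w(x⋆)` attained):
`mhKernel (fun _ z => q z) p` = the Metropolized independence sampler IMH (one proposal per update),
`isirKernel q p (n + 1)` = i-SIR / Barker–Tjelmeland pool selection with `n + 1` fresh proposals,
`mtmisKernel q p n` = the multiple-try Metropolized independence sampler MTM-IS(`n+1`)
(`MultipleTryIndependenceSampler.lean`); `spectralGapR` = Andrieu–Vihola's right spectral gap
`Gap_R` (`PeskunOrdering.lean`), `spectralGap` = Levin–Peres–Wilmer's `γ = 1 − λ₂`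
(`SpectralGapVariational.lean`), `absSpectralGap` / `relaxationTime` = `γ⋆ = 1 − λ⋆`, `t_rel = 1/γ⋆`
(`RelaxationTime.lean`).

Ingredients (all Literature, all proved): Pozza–Zanella 2025 Thm 1 / Cor 1 specialised to
independent proposals — `Gap_R(i-SIR_{n+1}) ≤ (n+1)·Gap_R(IMH)` and `Gap_R(MTM-IS(n+1)) ≤
(n+1)·Gap_R(IMH)` (`IndependenceMultiproposalGapBound.lean`); Liu 1996 / 2001 Thm 13.4.1 read through
Levin–Peres Lemma 13.7 — `Gap_R(IMH) = 1/W` and `t_rel(IMH) = W`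
(`IndependenceSamplerSpectralGap.lean`, `IndependenceSamplerSpectrum.lean`); Levin–Peres §12.2 —
`γ⋆ ≤ γ` for an irreducible reversible chain (`ReversibleSpectrumReal.absSpectralGap_le_spectralGap`);
Andrieu–Lee–Vihola 2018 Thm 1 — `t_rel(i-SIR_{n+1}) ≤ (2W + n)/(n + 1)`
(`MinorizationSpectralGap.isir_relaxationTime_le`); Yang–Liu 2021 / Liu's vectors —
`t_rel(MTM-IS(n+1)) = 1/H_{n+1}(W) ∈ [W/(n+1), (W+n)/(n+1)]`
(`MultipleTryIndependenceSamplerEigenvectors.mtmis_relaxationTime_bounds`).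

## Content

* `isir_spectralGapR_le`, `mtmis_spectralGapR_le` — **`Gap_R ≤ (n+1)/W`** for both multi-proposal
  kernels with `n + 1` fresh proposals.
* `isir_spectralGap_le`, `isir_absSpectralGap_le` — hence `γ(i-SIR) ≤ (n+1)/W` (Lemma 13.7, i-SIR
  is `p`-reversible) and `γ⋆(i-SIR) ≤ (n+1)/W` (irreducible: all entries positive).
* **`isir_relaxationTime_ge`** — **`W/(n+1) ≤ t_rel(i-SIR_{n+1})`**, the missing floor; with ALV's
  ceiling, **`isir_relaxationTime_sandwich`**: `W/(n+1) ≤ t_rel(i-SIR_{n+1}) ≤ (2W+n)/(n+1)`.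
* **`imh_relaxationTime_div_le_isir`**, **`imh_relaxationTime_div_le_mtmis`** — the reading for the
  lever: `t_rel(IMH)/(n+1) ≤ t_rel(i-SIR_{n+1})` and `t_rel(IMH)/(n+1) ≤ t_rel(MTM-IS(n+1))`: per
  update, `n + 1` i.i.d. proposals from the flow buy AT MOST a factor `n + 1` in relaxation time over
  the one-proposal Metropolized independence sampler — exactly the factor they cost in proposals and
  weight evaluations (so at equal proposal budget neither multi-proposal correction improves the
  relaxation time per proposal; what they can buy is parallel evaluation).

NOT CLAIMED: strictness of any inequality; the analogous statement for asymptotic variances of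
specific observables (Pozza–Zanella's Thm 1 gives `var(f, P̃)`-type bounds only up to the factor `K`
and an additive term — not restated here); dependent / correlated proposal mechanisms; general
state spaces; wall-clock or parallel cost models; anything about a specific flow or any number of
ours.
-/

namespace Summit.Ventures.LatticeQCDFlow.Scoring

open Finset Literature.Probability.MarkovChains

variable {X : Type*} [Fintype X] [DecidableEq X] {p q : X → ℝ}

omit [Fintype X] [DecidableEq X] in
/-- A weight bound `p ≤ W·q` with `p, q > 0` forces `W > 0` (helper). -/
private theorem weightBound_pos (hp : ∀ x, 0 < p x) (hq : ∀ x, 0 < q x) {W : ℝ}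
    (hW : ∀ x, p x ≤ W * q x) (x : X) : 0 < W :=
  pos_of_mul_pos_left ((hp x).trans_le (hW x)) (hq x).le

/-! ## `Gap_R ≤ (n+1)/W` for both multi-proposal corrections -/

/-- **`Gap_R(i-SIR_{n+1}) ≤ (n+1)/W`**: Pozza–Zanella's factor-`K` bound over IMH, with
`Gap_R(IMH) = 1/W`. -/
theorem isir_spectralGapR_le [Nontrivial X] (hp : ∀ x, 0 < p x) (hp1 : ∑ x, p x = 1)
    (hq : ∀ x, 0 < q x) (hq1 : ∑ x, q x = 1) {W : ℝ} (hW : ∀ x, p x ≤ W * q x) {xs : X}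
    (hxs : p xs = W * q xs) (n : ℕ) :
    spectralGapR p (isirKernel q p (n + 1) : Matrix X X ℝ) ≤ (n + 1) / W := by
  have h := spectralGapR_isir_le_mul_imh hp hq hq1 n (p := p)
  rw [imh_spectralGapR_eq hp hp1 hq hq1 hW hxs] at h
  rwa [div_eq_mul_inv]

/-- **`Gap_R(MTM-IS(n+1)) ≤ (n+1)/W`**: the same for the multiple-try rule. -/
theorem mtmis_spectralGapR_le [Nontrivial X] (hp : ∀ x, 0 < p x) (hp1 : ∑ x, p x = 1)
    (hq : ∀ x, 0 < q x) (hq1 : ∑ x, q x = 1) {W : ℝ} (hW : ∀ x, p x ≤ W * q x) {xs : X}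
    (hxs : p xs = W * q xs) (n : ℕ) :
    spectralGapR p (mtmisKernel q p n : Matrix X X ℝ) ≤ (n + 1) / W := by
  have h := spectralGapR_mtmis_le_mul_imh hp hq hq1 n (p := p)
  rw [imh_spectralGapR_eq hp hp1 hq hq1 hW hxs] at h
  rwa [div_eq_mul_inv]

/-! ## The pool-selection chain: `γ ≤ (n+1)/W`, `γ⋆ ≤ (n+1)/W`, `t_rel ≥ W/(n+1)` -/

/-- `γ(i-SIR_{n+1}) = 1 − λ₂ ≤ (n+1)/W` (Lemma 13.7: `γ = Gap_R` for the `p`-reversible i-SIR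
kernel). -/
theorem isir_spectralGap_le [Nontrivial X] (hp : ∀ x, 0 < p x) (hp1 : ∑ x, p x = 1)
    (hq : ∀ x, 0 < q x) (hq1 : ∑ x, q x = 1) {W : ℝ} (hW : ∀ x, p x ≤ W * q x) {xs : X}
    (hxs : p xs = W * q xs) (n : ℕ) :
    spectralGap p (isirKernel q p (n + 1) : Matrix X X ℝ) ≤ (n + 1) / W := by
  rw [LevinPeres2017_lemma_13_7 hp hp1 (isirKernel_isRowStochastic hp hq hq1 (n + 1))
    (isirKernel_detailedBalance hq (n + 1))]
  exact isir_spectralGapR_le hp hp1 hq hq1 hW hxs n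

/-- `γ⋆(i-SIR_{n+1}) ≤ γ(i-SIR_{n+1}) ≤ (n+1)/W` (the i-SIR kernel is irreducible: all entries
positive). -/
theorem isir_absSpectralGap_le [Nontrivial X] (hp : ∀ x, 0 < p x) (hp1 : ∑ x, p x = 1)
    (hq : ∀ x, 0 < q x) (hq1 : ∑ x, q x = 1) {W : ℝ} (hW : ∀ x, p x ≤ W * q x) {xs : X}
    (hxs : p xs = W * q xs) (n : ℕ) :
    absSpectralGap (isirKernel q p (n + 1)) ≤ (n + 1) / W :=
  (absSpectralGap_le_spectralGap hp hp1 (isirKernel_isRowStochastic hp hq hq1 (n + 1))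
    (isirKernel_detailedBalance hq (n + 1)) (isirKernel_isIrreducible hp hq n)).trans
    (isir_spectralGap_le hp hp1 hq hq1 hW hxs n)

/-- The absolute spectral gap of i-SIR is positive (ALV's minorisation: `λ⋆ ≤ 1 − (n+1)/(2W+n)`). -/
theorem isir_absSpectralGap_pos (hp : ∀ x, 0 < p x) (hp1 : ∑ x, p x = 1) (hq : ∀ x, 0 < q x)
    (hq1 : ∑ x, q x = 1) {W : ℝ} (hW : ∀ x, p x ≤ W * q x) (n : ℕ) :
    0 < absSpectralGap (isirKernel q p (n + 1)) := by
  obtain ⟨x₀⟩ : Nonempty X := by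
    rw [← not_isEmpty_iff]
    intro hX
    rw [Finset.univ_eq_empty, Finset.sum_empty] at hp1
    exact zero_ne_one hp1
  have hW0 : 0 < W := weightBound_pos hp hq hW x₀
  have h := isir_lambdaStar_le hp hp1 hq hq1 n hW
  have hε : (0 : ℝ) < (n + 1) / (2 * W + n) := by positivity
  unfold absSpectralGap
  linarith

/-- **THE FLOOR: `W/(n+1) ≤ t_rel(i-SIR_{n+1})`** — `n + 1` fresh proposals per update reduce the
relaxation time `W` of the one-proposal independence sampler by at most the factor `n + 1`. -/
theorem isir_relaxationTime_ge [Nontrivial X] (hp : ∀ x, 0 < p x) (hp1 : ∑ x, p x = 1)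
    (hq : ∀ x, 0 < q x) (hq1 : ∑ x, q x = 1) {W : ℝ} (hW : ∀ x, p x ≤ W * q x) {xs : X}
    (hxs : p xs = W * q xs) (n : ℕ) :
    W / (n + 1) ≤ relaxationTime (isirKernel q p (n + 1)) := by
  have hpos := isir_absSpectralGap_pos hp hp1 hq hq1 hW n
  have hle := isir_absSpectralGap_le hp hp1 hq hq1 hW hxs n
  unfold relaxationTime
  rw [← one_div_div (n + 1 : ℝ) W]
  exact one_div_le_one_div_of_le hpos hle

/-- **THE SANDWICH: `W/(n+1) ≤ t_rel(i-SIR_{n+1}) ≤ (2W+n)/(n+1)`** (floor: this file; ceiling: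
Andrieu–Lee–Vihola's minorisation, `MinorizationSpectralGap.isir_relaxationTime_le`). -/
theorem isir_relaxationTime_sandwich [Nontrivial X] (hp : ∀ x, 0 < p x) (hp1 : ∑ x, p x = 1)
    (hq : ∀ x, 0 < q x) (hq1 : ∑ x, q x = 1) {W : ℝ} (hW : ∀ x, p x ≤ W * q x) {xs : X}
    (hxs : p xs = W * q xs) (n : ℕ) :
    W / (n + 1) ≤ relaxationTime (isirKernel q p (n + 1)) ∧
      relaxationTime (isirKernel q p (n + 1)) ≤ (2 * W + n) / (n + 1) :=
  ⟨isir_relaxationTime_ge hp hp1 hq hq1 hW hxs n, isir_relaxationTime_le hp hp1 hq hq1 n hW⟩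

/-! ## The reading for the lever: `t_rel(IMH)/(n+1) ≤ t_rel` of either `(n+1)`-proposal correction -/

/-- **`t_rel(IMH)/(n+1) ≤ t_rel(i-SIR_{n+1})`**: at `n + 1` i.i.d. proposals per update the
pool-selection rule improves the relaxation time of the Metropolized independence sampler
(`t_rel(IMH) = W`) by at most the factor `n + 1`. -/
theorem imh_relaxationTime_div_le_isir [Nontrivial X] (hp : ∀ x, 0 < p x) (hp1 : ∑ x, p x = 1)
    (hq : ∀ x, 0 < q x) (hq1 : ∑ x, q x = 1) {W : ℝ} (hW : ∀ x, p x ≤ W * q x) {xs : X}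
    (hxs : p xs = W * q xs) (n : ℕ) :
    relaxationTime (mhKernel (fun _ z => q z) p) / (n + 1) ≤
      relaxationTime (isirKernel q p (n + 1)) := by
  rw [imh_relaxationTime_eq hp hp1 hq hq1 hW hxs (exists_ne xs)]
  exact isir_relaxationTime_ge hp hp1 hq hq1 hW hxs n

/-- **`t_rel(IMH)/(n+1) ≤ t_rel(MTM-IS(n+1))`**: the same for the multiple-try rule (whose
relaxation time is exactly `1/H_{n+1}(W) ≥ W/(n+1)`). -/
theorem imh_relaxationTime_div_le_mtmis (hp : ∀ x, 0 < p x) (hp1 : ∑ x, p x = 1)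
    (hq : ∀ x, 0 < q x) (hq1 : ∑ x, q x = 1) {W : ℝ} (hW : ∀ x, p x ≤ W * q x) {xs : X}
    (hxs : p xs = W * q xs) (hX : ∃ y, y ≠ xs) (n : ℕ) :
    relaxationTime (mhKernel (fun _ z => q z) p) / (n + 1) ≤
      relaxationTime (mtmisKernel q p n) := by
  rw [imh_relaxationTime_eq hp hp1 hq hq1 hW hxs hX]
  exact (mtmis_relaxationTime_bounds hp hp1 hq hq1 n hW hxs hX).1

/-- Both floors at once, with the i-SIR floor also written through the Peskun order of
`MultiProposalPeskun.lean` (`Gap_R(i-SIR) ≤ Gap_R(MTM-IS) ≤ (n+1)/W`): at equal proposal count the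
three right spectral gaps are ordered `Gap_R(i-SIR_{n+1}) ≤ Gap_R(MTM-IS(n+1)) ≤ (n+1)·Gap_R(IMH)`. -/
theorem spectralGapR_chain [Nontrivial X] (hp : ∀ x, 0 < p x) (hp1 : ∑ x, p x = 1)
    (hq : ∀ x, 0 < q x) (hq1 : ∑ x, q x = 1) {W : ℝ} (hW : ∀ x, p x ≤ W * q x) {xs : X}
    (hxs : p xs = W * q xs) (n : ℕ) :
    spectralGapR p (isirKernel q p (n + 1) : Matrix X X ℝ) ≤
        spectralGapR p (mtmisKernel q p n : Matrix X X ℝ) ∧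
      spectralGapR p (mtmisKernel q p n : Matrix X X ℝ) ≤
        (n + 1) * spectralGapR p (mhKernel (fun _ z => q z) p : Matrix X X ℝ) ∧
      (n + 1) * spectralGapR p (mhKernel (fun _ z => q z) p : Matrix X X ℝ) = (n + 1) / W :=
  ⟨spectralGapR_isir_le_mtmis hp hq hq1 n, spectralGapR_mtmis_le_mul_imh hp hq hq1 n,
    by rw [imh_spectralGapR_eq hp hp1 hq hq1 hW hxs, div_eq_mul_inv]⟩

end Summit.Ventures.LatticeQCDFlow.Scoring
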